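import Summits.AtomisticToContinuum.Crystallization.Theorems.FrustratedLawDichotomyStrainedPatchHomValueT2SlopeSoundQ
import Summits.AtomisticToContinuum.Crystallization.Theorems.FrustratedLawDichotomyStrainedPatchHomSignedWellKappa

/-!
# (I1) SOCKET PLUMBING — the T2 certificate leaves feed `hcpEnergy_of_ballLeaves_signed` / `_kappa`
# (27623 `(H) HomFloor`, hcp half, E-zone near boxes; critic rows 1674 (B) (I1) docket, 1719 (D); decomp-a2c hand-1 g50)

The ζ-centred sockets `…HomSignedWell.hcpEnergy_of_ballLeaves_signed` (diameter `5/4·r`) and `…SignedWellKappa.hcpEnergy_of_ballLeaves_kappa`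
(diameter `κ·r`) take, per `U`-box `Zb`, a track `σ U`, a VALUE floor at the track (`hval`), a SLOPE bound at the track (`hslope`) and a curvature
floor on the ball (`hcurv`).  The (I1) docket landed the certified producers of the first two for the T2 kernel: `valueLeafT2T_sound` (…SoundZT)
and `slopeT2_sound'` (…SlopeSoundQ), both stated on the affine track `ξ_m = c_m/SC + Σ_e (aP m e/SC)·dispN (U − cenMap c) 0 e` (`hξσ`).
This file is the plumbing, with NO new definitions: the track is any function `σ` satisfying `hσ` (the `hξσ` identity at every `U`), the box
predicate is `Zb U := (U self-adjoint) ∧ (entries of U in the box (c, w))`, `SA U := Σ_{A-box, b ≠ 0} W(‖latPt U hexFrame b‖)`,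
`V₀ := (μ − 1)/SC`, `G := √(Σ_a (G_a + 41·#nearB)²)/SC`, `B :=` the `[−7, 7]³` box.

* §1 `hval_of_valueLeafT2T` — the socket's `hval` from `valueLeafT2T μ c w aP = true`;
  `hslope_of_slopeT2` — the socket's `hslope` from `(t2SlopeT2 c w aP).1 = true`, `.2.1 = (G 0, G 1, G 2)`; `sqrtG_div_SC_nonneg`.
* §2 ★ `hcpEnergy_of_t2Leaves_kappa` / ★ `hcpEnergy_of_t2Leaves_signed` — for every self-adjoint `U` in the entry box with `‖U − 1‖ ≤ 1/4`,
  `‖σ U‖ ≤ 1/4`, and every shuffle `ξ` with `‖ξ − σ U‖ ≤ r`, `‖ξ‖ ≤ 1/4`: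
  `(μ − 1)/SC − G·D + (min λ 0/2)·D² ≤ Σ_A W(‖latPt U hexFrame b‖) + Σ_B W(‖latPt U hexFrame b + U(hcpShift + ξ)‖)`, `D = κ·r` resp. `5/4·r`,
  from the two certificate flags, the box-side numerics of the producers, and an abstract curvature leaf `hcurv` (any sign `λ`; producers:
  `…HomCurvLeafL2.curv_floor_of_curvCheckL2` and kin, or the κ-kernel of `…TrackKernel`).

Remaining socket inputs NOT produced here (by design): `hcurv`, `hκ` (`‖U v‖ ≤ κ‖v‖` on the box; `κ = 5/4` is `…HomPolar.norm_apply_le_of_norm_sub_one_le`),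
and the energy → ball-average step of `…HomShearFrames.homFloorHcp_of_piecewiseSheet_boxes`.  Def-free; 0 sorry; standard axioms.
`--supports stmt-AtomisticToContinuum-27623`.  [formal bookkeeping]
-/

noncomputable section

namespace Summit.AtomisticToContinuum.Crystallization.Theorems.FrustratedLawDichotomyStrainedPatchHomValueT2Kit

open scoped BigOperators RealInnerProductSpace
open Finset
open Literature.Analysis.ValidatedNumerics.Numerics
open Summit.AtomisticToContinuum.Crystallization.Theorems.ChargedEnergyGapNegative (E3)
open Summit.AtomisticToContinuum.Crystallization.Theorems.FrustratedLawDichotomySchurCut (effPot w₄₅ ω₄)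
open Summit.AtomisticToContinuum.Crystallization.Theorems.FrustratedLawDichotomyStrainedPatchTaylorLeaves (junctions)
open Summit.AtomisticToContinuum.Crystallization.Theorems.FrustratedLawDichotomyStrainedPatchTaylorChord (segR segG segGd)
open Summit.AtomisticToContinuum.Crystallization.Theorems.FrustratedLawDichotomyStrainedPatchHomSplit (latPt hexFrame hcpShift)
open Summit.AtomisticToContinuum.Crystallization.Theorems.FrustratedLawDichotomyStrainedPatchHomCurvCentreKit (cenMap cenShuf)
open Summit.AtomisticToContinuum.Crystallization.Theorems.FrustratedLawDichotomyStrainedPatchHomSignedWell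
  (hcpEnergy_of_ballLeaves_signed hcpEnergy_of_ballLeaves_kappa)

/-! ## §1. The socket hypotheses `hval` / `hslope` from the T2 leaves -/

/-- ★ **`hval` PRODUCER.**  The value flag `valueLeafT2T μ c w aP = true` (with the box-side numerics of `valueLeafT2T_sound`) yields the socket's
value hypothesis AT THE TRACK `σ U` for every self-adjoint `U` in the entry box: `(μ − 1)/SC ≤ Σ_A W(‖latPt U · b‖) + Σ_B W(‖latPt U · b + U(hcpShift + σ U)‖)`.
The binders `‖U − 1‖ ≤ 1/4`, `‖σ U‖ ≤ 1/4` are the socket's and are not used. [formal bookkeeping] -/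
theorem hval_of_valueLeafT2T {μ : ℤ} {c w : (Fin 3 × Fin 3) ⊕ Fin 3 → ℤ} {aP : Fin 3 → Fin 6 → ℤ} (hleaf : valueLeafT2T μ c w aP = true)
    (hU1 : ‖cenMap c - 1‖ ≤ 1 / 4) (hw_inr : ∀ m : Fin 3, 0 ≤ w (Sum.inr m)) (hw1 : ∀ p : Fin 9, foldW (trackW aP w) p ≤ (SC : ℤ))
    (hJA : ∀ b ∈ nearA c (trackW aP w), ‖latPt (cenMap c) hexFrame b‖ ∉ junctions)
    (hJB : ∀ b ∈ nearB c (trackW aP w), ‖latPt (cenMap c) hexFrame b + cenMap c (hcpShift + cenShuf c)‖ ∉ junctions)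
    (σ : (E3 →L[ℝ] E3) → E3)
    (hσ : ∀ U : E3 →L[ℝ] E3, ∀ m : Fin 3, σ U m = (c (Sum.inr m) : ℝ) / SC + ∑ e : Fin 6, ((aP m e : ℤ) : ℝ) / SC * dispN (U - cenMap c) 0 e) :
    ∀ U : E3 →L[ℝ] E3, ((∀ v v' : E3, ⟪U v, v'⟫ = ⟪v, U v'⟫) ∧
        ∀ ab : Fin 3 × Fin 3, |(U (EuclideanSpace.single ab.2 (1 : ℝ))) ab.1 - (c (Sum.inl ab) : ℝ) / SC| ≤ (w (Sum.inl ab) : ℝ) / SC) →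
      ‖U - 1‖ ≤ 1 / 4 → ‖σ U‖ ≤ 1 / 4 →
      ((μ : ℝ) - 1) / SC ≤
        (∑ b ∈ (Fintype.piFinset fun _ : Fin 3 => Finset.Icc (-7 : ℤ) 7).filter (fun b => b ≠ 0), effPot w₄₅ ω₄ (3 / 400) ‖latPt U hexFrame b‖) +
          ∑ b ∈ (Fintype.piFinset fun _ : Fin 3 => Finset.Icc (-7 : ℤ) 7), effPot w₄₅ ω₄ (3 / 400) ‖latPt U hexFrame b + U (hcpShift + σ U)‖ :=
  fun U hZ _ _ => valueLeafT2T_sound hleaf hU1 hw_inr hw1 U (σ U) hZ.1 hZ.2 (hσ U) hJA hJB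

/-- ★ **`hslope` PRODUCER.**  The slope flag `(t2SlopeT2 c w aP).1 = true` with reported bound `(G 0, G 1, G 2)` yields the socket's slope hypothesis AT THE
TRACK with constant `√(Σ_a (G_a + 41·#nearB)²)/SC`, for every self-adjoint `U` in the entry box and every `ξ` (direction `U(ξ − σ U)`). [formal bookkeeping] -/
theorem hslope_of_slopeT2 {c w : (Fin 3 × Fin 3) ⊕ Fin 3 → ℤ} {aP : Fin 3 → Fin 6 → ℤ} {G : Fin 3 → ℤ} (hflag : (t2SlopeT2 c w aP).1 = true)
    (hG : (t2SlopeT2 c w aP).2.1 = (G 0, G 1, G 2))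
    (hc : ∀ a b : Fin 3, c (Sum.inl (a, b)) = c (Sum.inl (b, a))) (hw_inr : ∀ m : Fin 3, 0 ≤ w (Sum.inr m))
    (hwpos : ∀ p : Fin 9, 0 < foldW (trackW aP w) p) (hw1 : ∀ p : Fin 9, foldW (trackW aP w) p ≤ (SC : ℤ))
    (hJB : ∀ b ∈ nearB c (trackW aP w), ‖latPt (cenMap c) hexFrame b + cenMap c (hcpShift + cenShuf c)‖ ∉ junctions)
    (σ : (E3 →L[ℝ] E3) → E3)
    (hσ : ∀ U : E3 →L[ℝ] E3, ∀ m : Fin 3, σ U m = (c (Sum.inr m) : ℝ) / SC + ∑ e : Fin 6, ((aP m e : ℤ) : ℝ) / SC * dispN (U - cenMap c) 0 e) :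
    ∀ (U : E3 →L[ℝ] E3) (ξ : E3), ((∀ v v' : E3, ⟪U v, v'⟫ = ⟪v, U v'⟫) ∧
        ∀ ab : Fin 3 × Fin 3, |(U (EuclideanSpace.single ab.2 (1 : ℝ))) ab.1 - (c (Sum.inl ab) : ℝ) / SC| ≤ (w (Sum.inl ab) : ℝ) / SC) →
      ‖U - 1‖ ≤ 1 / 4 → ‖σ U‖ ≤ 1 / 4 →
      |∑ b ∈ (Fintype.piFinset fun _ : Fin 3 => Finset.Icc (-7 : ℤ) 7),
          segG (deriv (effPot w₄₅ ω₄ (3 / 400))) (latPt U hexFrame b + U (hcpShift + σ U)) (U (ξ - σ U)) 0| ≤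
        Real.sqrt (∑ a : Fin 3, (((G a + 41 * ((nearB c (trackW aP w)).length : ℤ) : ℤ)) : ℝ) ^ 2) / SC * ‖U (ξ - σ U)‖ :=
  fun U ξ hZ _ _ => slopeT2_sound' hflag hG hc hw_inr hwpos hw1 U (σ U) hZ.1 hZ.2 (hσ U) hJB (U (ξ - σ U))

/-- The slope constant `√(Σ_a (G_a + 41·#nearB)²)/SC` is non-negative. [formal bookkeeping] -/
theorem sqrtG_div_SC_nonneg (x : Fin 3 → ℝ) : 0 ≤ Real.sqrt (∑ a : Fin 3, x a ^ 2) / SC :=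
  div_nonneg (Real.sqrt_nonneg _) (le_of_lt SC_pos)

/-! ## §2. The sockets discharged on their value and slope legs -/

/-- ★★ **T2 LEAVES ⟹ κ-SOCKET.**  Value flag + slope flag (with their box-side numerics), an operator-norm bound `κ` on the box and an abstract
curvature floor `λ` (any sign) on the `r`-ball give, for every self-adjoint `U` in the entry box with `‖U − 1‖ ≤ 1/4`, `‖σ U‖ ≤ 1/4` and every `ξ`
with `‖ξ − σ U‖ ≤ r`, `‖ξ‖ ≤ 1/4`:
`(μ − 1)/SC − G·(κr) + (min λ 0/2)·(κr)² ≤ Σ_A W(‖latPt U hexFrame b‖) + Σ_B W(‖latPt U hexFrame b + U(hcpShift + ξ)‖)`,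
`G = √(Σ_a (G_a + 41·#nearB)²)/SC` — `…SignedWellKappa.hcpEnergy_of_ballLeaves_kappa` with `hval`/`hslope` discharged by §1. [formal bookkeeping] -/
theorem hcpEnergy_of_t2Leaves_kappa {μ : ℤ} {c w : (Fin 3 × Fin 3) ⊕ Fin 3 → ℤ} {aP : Fin 3 → Fin 6 → ℤ} {G : Fin 3 → ℤ}
    (hleaf : valueLeafT2T μ c w aP = true) (hflag : (t2SlopeT2 c w aP).1 = true) (hG : (t2SlopeT2 c w aP).2.1 = (G 0, G 1, G 2))
    (hU1 : ‖cenMap c - 1‖ ≤ 1 / 4) (hc : ∀ a b : Fin 3, c (Sum.inl (a, b)) = c (Sum.inl (b, a))) (hw_inr : ∀ m : Fin 3, 0 ≤ w (Sum.inr m))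
    (hwpos : ∀ p : Fin 9, 0 < foldW (trackW aP w) p) (hw1 : ∀ p : Fin 9, foldW (trackW aP w) p ≤ (SC : ℤ))
    (hJA : ∀ b ∈ nearA c (trackW aP w), ‖latPt (cenMap c) hexFrame b‖ ∉ junctions)
    (hJB : ∀ b ∈ nearB c (trackW aP w), ‖latPt (cenMap c) hexFrame b + cenMap c (hcpShift + cenShuf c)‖ ∉ junctions)
    (σ : (E3 →L[ℝ] E3) → E3)
    (hσ : ∀ U : E3 →L[ℝ] E3, ∀ m : Fin 3, σ U m = (c (Sum.inr m) : ℝ) / SC + ∑ e : Fin 6, ((aP m e : ℤ) : ℝ) / SC * dispN (U - cenMap c) 0 e)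
    {r lam κ : ℝ}
    (hκ : ∀ U : E3 →L[ℝ] E3, ((∀ v v' : E3, ⟪U v, v'⟫ = ⟪v, U v'⟫) ∧
        ∀ ab : Fin 3 × Fin 3, |(U (EuclideanSpace.single ab.2 (1 : ℝ))) ab.1 - (c (Sum.inl ab) : ℝ) / SC| ≤ (w (Sum.inl ab) : ℝ) / SC) →
      ∀ v : E3, ‖U v‖ ≤ κ * ‖v‖)
    (hcurv : ∀ (U : E3 →L[ℝ] E3) (ξ : E3), ((∀ v v' : E3, ⟪U v, v'⟫ = ⟪v, U v'⟫) ∧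
        ∀ ab : Fin 3 × Fin 3, |(U (EuclideanSpace.single ab.2 (1 : ℝ))) ab.1 - (c (Sum.inl ab) : ℝ) / SC| ≤ (w (Sum.inl ab) : ℝ) / SC) →
      ‖U - 1‖ ≤ 1 / 4 → ‖σ U‖ ≤ 1 / 4 → ‖ξ - σ U‖ ≤ r → ‖ξ‖ ≤ 1 / 4 →
      ∀ s ∈ Set.Ioo (0 : ℝ) 1, (∀ b ∈ (Fintype.piFinset fun _ : Fin 3 => Finset.Icc (-7 : ℤ) 7),
        segR (latPt U hexFrame b + U (hcpShift + σ U)) (U (ξ - σ U)) s ∉ junctions) →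
      lam * ‖U (ξ - σ U)‖ ^ 2 ≤ ∑ b ∈ (Fintype.piFinset fun _ : Fin 3 => Finset.Icc (-7 : ℤ) 7),
        segGd (deriv (effPot w₄₅ ω₄ (3 / 400))) (latPt U hexFrame b + U (hcpShift + σ U)) (U (ξ - σ U)) s)
    (U : E3 →L[ℝ] E3) (hsa : ∀ v v' : E3, ⟪U v, v'⟫ = ⟪v, U v'⟫)
    (hbox : ∀ ab : Fin 3 × Fin 3, |(U (EuclideanSpace.single ab.2 (1 : ℝ))) ab.1 - (c (Sum.inl ab) : ℝ) / SC| ≤ (w (Sum.inl ab) : ℝ) / SC)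
    (hU : ‖U - 1‖ ≤ 1 / 4) (hσU : ‖σ U‖ ≤ 1 / 4) (ξ : E3) (hξ : ‖ξ - σ U‖ ≤ r) (hn : ‖ξ‖ ≤ 1 / 4) :
    ((μ : ℝ) - 1) / SC - Real.sqrt (∑ a : Fin 3, (((G a + 41 * ((nearB c (trackW aP w)).length : ℤ) : ℤ)) : ℝ) ^ 2) / SC * (κ * r) +
        min lam 0 / 2 * (κ * r) ^ 2 ≤
      (∑ b ∈ (Fintype.piFinset fun _ : Fin 3 => Finset.Icc (-7 : ℤ) 7).filter (fun b => b ≠ 0), effPot w₄₅ ω₄ (3 / 400) ‖latPt U hexFrame b‖) +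
        ∑ b ∈ (Fintype.piFinset fun _ : Fin 3 => Finset.Icc (-7 : ℤ) 7), effPot w₄₅ ω₄ (3 / 400) ‖latPt U hexFrame b + U (hcpShift + ξ)‖ :=
  hcpEnergy_of_ballLeaves_kappa (Fintype.piFinset fun _ : Fin 3 => Finset.Icc (-7 : ℤ) 7)
    (fun U : E3 →L[ℝ] E3 => (∀ v v' : E3, ⟪U v, v'⟫ = ⟪v, U v'⟫) ∧
      ∀ ab : Fin 3 × Fin 3, |(U (EuclideanSpace.single ab.2 (1 : ℝ))) ab.1 - (c (Sum.inl ab) : ℝ) / SC| ≤ (w (Sum.inl ab) : ℝ) / SC)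
    σ (sqrtG_div_SC_nonneg _)
    (fun U : E3 →L[ℝ] E3 =>
      ∑ b ∈ (Fintype.piFinset fun _ : Fin 3 => Finset.Icc (-7 : ℤ) 7).filter (fun b => b ≠ 0), effPot w₄₅ ω₄ (3 / 400) ‖latPt U hexFrame b‖)
    hκ (hval_of_valueLeafT2T hleaf hU1 hw_inr hw1 hJA hJB σ hσ) (hslope_of_slopeT2 hflag hG hc hw_inr hwpos hw1 hJB σ hσ) hcurv
    U ⟨hsa, hbox⟩ hU hσU ξ hξ hn

/-- ★★ **T2 LEAVES ⟹ SIGNED SOCKET (diameter `5/4·r`).**  As `hcpEnergy_of_t2Leaves_kappa` with `…HomSignedWell.hcpEnergy_of_ballLeaves_signed`: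
no `κ` input (the `5/4` comes from `‖U − 1‖ ≤ 1/4`). [formal bookkeeping] -/
theorem hcpEnergy_of_t2Leaves_signed {μ : ℤ} {c w : (Fin 3 × Fin 3) ⊕ Fin 3 → ℤ} {aP : Fin 3 → Fin 6 → ℤ} {G : Fin 3 → ℤ}
    (hleaf : valueLeafT2T μ c w aP = true) (hflag : (t2SlopeT2 c w aP).1 = true) (hG : (t2SlopeT2 c w aP).2.1 = (G 0, G 1, G 2))
    (hU1 : ‖cenMap c - 1‖ ≤ 1 / 4) (hc : ∀ a b : Fin 3, c (Sum.inl (a, b)) = c (Sum.inl (b, a))) (hw_inr : ∀ m : Fin 3, 0 ≤ w (Sum.inr m))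
    (hwpos : ∀ p : Fin 9, 0 < foldW (trackW aP w) p) (hw1 : ∀ p : Fin 9, foldW (trackW aP w) p ≤ (SC : ℤ))
    (hJA : ∀ b ∈ nearA c (trackW aP w), ‖latPt (cenMap c) hexFrame b‖ ∉ junctions)
    (hJB : ∀ b ∈ nearB c (trackW aP w), ‖latPt (cenMap c) hexFrame b + cenMap c (hcpShift + cenShuf c)‖ ∉ junctions)
    (σ : (E3 →L[ℝ] E3) → E3)
    (hσ : ∀ U : E3 →L[ℝ] E3, ∀ m : Fin 3, σ U m = (c (Sum.inr m) : ℝ) / SC + ∑ e : Fin 6, ((aP m e : ℤ) : ℝ) / SC * dispN (U - cenMap c) 0 e)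
    {r lam : ℝ}
    (hcurv : ∀ (U : E3 →L[ℝ] E3) (ξ : E3), ((∀ v v' : E3, ⟪U v, v'⟫ = ⟪v, U v'⟫) ∧
        ∀ ab : Fin 3 × Fin 3, |(U (EuclideanSpace.single ab.2 (1 : ℝ))) ab.1 - (c (Sum.inl ab) : ℝ) / SC| ≤ (w (Sum.inl ab) : ℝ) / SC) →
      ‖U - 1‖ ≤ 1 / 4 → ‖σ U‖ ≤ 1 / 4 → ‖ξ - σ U‖ ≤ r → ‖ξ‖ ≤ 1 / 4 →
      ∀ s ∈ Set.Ioo (0 : ℝ) 1, (∀ b ∈ (Fintype.piFinset fun _ : Fin 3 => Finset.Icc (-7 : ℤ) 7),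
        segR (latPt U hexFrame b + U (hcpShift + σ U)) (U (ξ - σ U)) s ∉ junctions) →
      lam * ‖U (ξ - σ U)‖ ^ 2 ≤ ∑ b ∈ (Fintype.piFinset fun _ : Fin 3 => Finset.Icc (-7 : ℤ) 7),
        segGd (deriv (effPot w₄₅ ω₄ (3 / 400))) (latPt U hexFrame b + U (hcpShift + σ U)) (U (ξ - σ U)) s)
    (U : E3 →L[ℝ] E3) (hsa : ∀ v v' : E3, ⟪U v, v'⟫ = ⟪v, U v'⟫)
    (hbox : ∀ ab : Fin 3 × Fin 3, |(U (EuclideanSpace.single ab.2 (1 : ℝ))) ab.1 - (c (Sum.inl ab) : ℝ) / SC| ≤ (w (Sum.inl ab) : ℝ) / SC)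
    (hU : ‖U - 1‖ ≤ 1 / 4) (hσU : ‖σ U‖ ≤ 1 / 4) (ξ : E3) (hξ : ‖ξ - σ U‖ ≤ r) (hn : ‖ξ‖ ≤ 1 / 4) :
    ((μ : ℝ) - 1) / SC - Real.sqrt (∑ a : Fin 3, (((G a + 41 * ((nearB c (trackW aP w)).length : ℤ) : ℤ)) : ℝ) ^ 2) / SC * (5 / 4 * r) +
        min lam 0 / 2 * (5 / 4 * r) ^ 2 ≤
      (∑ b ∈ (Fintype.piFinset fun _ : Fin 3 => Finset.Icc (-7 : ℤ) 7).filter (fun b => b ≠ 0), effPot w₄₅ ω₄ (3 / 400) ‖latPt U hexFrame b‖) +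
        ∑ b ∈ (Fintype.piFinset fun _ : Fin 3 => Finset.Icc (-7 : ℤ) 7), effPot w₄₅ ω₄ (3 / 400) ‖latPt U hexFrame b + U (hcpShift + ξ)‖ :=
  hcpEnergy_of_ballLeaves_signed (Fintype.piFinset fun _ : Fin 3 => Finset.Icc (-7 : ℤ) 7)
    (fun U : E3 →L[ℝ] E3 => (∀ v v' : E3, ⟪U v, v'⟫ = ⟪v, U v'⟫) ∧
      ∀ ab : Fin 3 × Fin 3, |(U (EuclideanSpace.single ab.2 (1 : ℝ))) ab.1 - (c (Sum.inl ab) : ℝ) / SC| ≤ (w (Sum.inl ab) : ℝ) / SC)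
    σ (sqrtG_div_SC_nonneg _)
    (fun U : E3 →L[ℝ] E3 =>
      ∑ b ∈ (Fintype.piFinset fun _ : Fin 3 => Finset.Icc (-7 : ℤ) 7).filter (fun b => b ≠ 0), effPot w₄₅ ω₄ (3 / 400) ‖latPt U hexFrame b‖)
    (hval_of_valueLeafT2T hleaf hU1 hw_inr hw1 hJA hJB σ hσ) (hslope_of_slopeT2 hflag hG hc hw_inr hwpos hw1 hJB σ hσ) hcurv
    U ⟨hsa, hbox⟩ hU hσU ξ hξ hn

end Summit.AtomisticToContinuum.Crystallization.Theorems.FrustratedLawDichotomyStrainedPatchHomValueT2Kit
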